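import Summits.QuantumFields.BalabanUV.T4Continuum.Support.NE7GaugeFixOnPureGauges
import Summits.QuantumFields.BalabanUV.T4Continuum.Support.NE7BalabanSoftOperatorMass
import Summits.QuantumFields.BalabanUV.T4Continuum.Support.NE7HessGaugePairingBound
import Summits.QuantumFields.BalabanUV.T4Continuum.Support.NE3CornerGaugePoincare
import HarnessLib

/-!
# NE7SoftOperatorGaugePositivity — THE PURE-GAUGE DIAGONAL OF (P_a): for `μ ∈ N(Q′(W))` and `g = D_Wμ` on the skew torus 1-forms,
# `⟪g, softSymOpKa a g⟫ ≥ B·(1∕(4M²) − τ·card n·(4dM²ε + ε⁻¹))` for every `ε > 0`, where `B = Σ nhsNormSq(D_Wμ)` — from F209 (the gauge-fixing square is `‖Δ_Wμ‖²`), row NE3's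
# scalar Poincaré for nested-mean-zero gauge functions (`‖μ‖² ≤ 4M²‖D_Wμ‖²`, hence `‖Δ_Wμ‖² ≥ ‖D_Wμ‖²∕(4M²)` by Cauchy–Schwarz) and F208 (`|hess(D_Wμ, D_Wμ)| ≤ 2τΣ‖μ‖‖D_Wμ‖`,
# tension-small); with `ε = 1∕(2M√d)` the bracket is `1∕(4M²) − 4τ·card n·√d·M`, positive in the class (`τ ≍ c∕M³`) (file 139 of the curved (APE), F210)

Cell `pub-balaban`, rung (B)+1 sub-cell t4, lineage `b2b-balaban-t4-ne7-p1` (CRUX PROVER NE7 #1 = OWNER of row NE7), generation 85; memo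
`t4/b2b-balaban-t4-ne7-p1-g85/LAGRANGE-CARRIER.md` §10–§11.  Over F202 `inner_softSymOpKa_self`, F209 (`inner_gaugeFix_pureGauge`, `coe_gradOpK_resS`, `resS_mem_of_avgKernel`), F208
`abs_hess_gaugeDir_right_le`, row NE3's `NE3CornerGaugePoincare.sum_nhsNormSq_le_four_mul_of_bmeanIterW_eq_zero`, `NE3LandauOrbit.sum_hsR_gaugeDir`,
`LandauProjectionB8.covDiv_gaugeDir_eq_covLapSite`, `MatrixNorms.opNorm_sq_le_card_mul_nhsNormSq` BY NAME.
WHAT ([folklore]; 0 def, 0 sorry).  §1 `sum_nhsNormSq_gaugeDir_eq_sum_hsR_covLapSite` (`‖D_Wμ‖² = ⟨Δ_Wμ, μ⟩`), `sum_nhsNormSq_gaugeDir_le_covLap` (`‖D_Wμ‖² ≤ 4M²·‖Δ_Wμ‖²` under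
row NE3's Poincaré smallness line); §2 `abs_hess_pureGauge_le` (`|hess W (D_Wμ)(D_Wμ)| ≤ τ·card n·(ε·Σ_xΣ_κ nhsNormSq(μ x) + ε⁻¹·Σ nhsNormSq(D_Wμ))`, AM–GM);
§3 **`inner_softSymOpKa_pureGauge_ge`** (the title bound).
HONEST FRAMING (page 1): inequalities over row NE3's kernel theorems; the tension letter and row NE3's Poincaré smallness line are DISPLAYED HYPOTHESES (class theorems elsewhere);
(P_a) on ALL skew forms NOT proved (slice∕gauge∕lift decomposition and cross terms remain); (KL-B) at curved `W` NOT proved; (APE) on curved data NOT proved; NOT ONE-STEP, NOT NE7;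
spine 0∕9; finite T⁴ rung (B)+1 — NOT infinite volume, NOT mass gap, NOT `BetaPertH`, NOT Clay.  Continuum YM on T⁴ ⇐ BetaPertH ∧ nine spine estimates (0/9 proved); BetaPertH ⇐
(D1) ∧ (D4) ∧ CAP+tail; G-an2-4 gates asym, D1 and NE2/3/4.
-/

set_option autoImplicit false

open scoped BigOperators InnerProductSpace Matrix Matrix.Norms.L2Operator
open Finset

namespace Summit.QuantumFields.BalabanUV.T4Continuum.NE7SoftOperatorGaugePositivity

open Literature.MathematicalPhysics.QuantumFieldTheory.Balaban1983to89
open B7Prop1Explicit B7Prop2Explicit UnitaryModel MatrixNorms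
open T4AveragingDeficitWall (IsUnitaryCfg IsSkewDir SmallField dirL1)
open T4AveragingDeficitWallBoundary (periodBox IsPeriodicCfg)
open AveragingDeficitPeriodicCounting (IsPeriodicDir)
open AveragingDeficitMultiLevelPrep (LevelSmall)
open AveragingDeficitTwoLevelPrep (prop1Radius)
open SpreadLift (loopRad)
open MinimalActionLevels (perWin)
open BlockAveragePushDirGauge (gaugeDir isPeriodicDir_gaugeDir)
open NE3HessForm (hess dAction)
open NE3CovariantCalculus (hsR hsR_self)
open NE3HilbertSchmidtTorus
open NE3LandauOrbit (gaugeDir_skew sum_hsR_gaugeDir)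
open NE3.PairLandauB8 (avgKernelGauges covLapSite mem_avgKernelGauges_iff)
open NE3.LandauProjectionB8 (covDiv_gaugeDir_eq_covLapSite covLapSite_add_period)
open NE3CovariantBlockMean (bmeanIterW)
open NE3CornerGaugePoincare (sum_nhsNormSq_le_four_mul_of_bmeanIterW_eq_zero)
open NE7BalabanSoftOperator
open NE7BalabanSoftOperatorMass
open NE7GaugeFixOnPureGauges (resS_mem_of_avgKernel coe_gradOpK_resS inner_gaugeFix_pureGauge)
open NE7HessGaugePairingBound (abs_hess_gaugeDir_right_le)

noncomputable section

variable {d : ℕ} {n : Type*} [Fintype n] [DecidableEq n]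

/-! ## §1 `‖D_Wμ‖² = ⟨Δ_Wμ, μ⟩` and the Poincaré consequence `‖D_Wμ‖² ≤ 4M²‖Δ_Wμ‖²` -/

/-- **`Σ nhsNormSq(D_Wμ) = Σ_x hsR (Δ_Wμ x) (μ x)`** over one period (periodic summation by parts). [folklore] -/
theorem sum_nhsNormSq_gaugeDir_eq_sum_hsR_covLapSite {P : ℕ} (hP : 1 ≤ P) {W : Site d → Fin d → (Matrix n n ℂ)ˣ} (hWu : IsUnitaryCfg W)
    (hWP : IsPeriodicCfg W (P : ℤ)) {μ : Site d → Matrix n n ℂ} (hμP : ∀ (x : Site d) (i : Fin d), μ (x + (P : ℤ) • e i) = μ x) :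
    ∑ x ∈ periodBox (d := d) P, ∑ κ : Fin d, nhsNormSq (gaugeDir W μ x κ) = ∑ x ∈ periodBox (d := d) P, hsR (covLapSite W μ x) (μ x) := by
  have h := sum_hsR_gaugeDir hP hWu (isPeriodicDir_gaugeDir hWP hμP) hμP (Y := gaugeDir W μ)
  rw [covDiv_gaugeDir_eq_covLapSite] at h
  rw [← h]
  exact Finset.sum_congr rfl fun x _ => Finset.sum_congr rfl fun κ _ => (hsR_self _).symm

/-- **`‖D_Wμ‖² ≤ 4M²·‖Δ_Wμ‖²`** for a nested-mean-zero gauge function (`bmeanIterW L (j+1) W μ = 0`), from row NE3's Poincaré `‖μ‖² ≤ 4M²‖D_Wμ‖²` and Cauchy–Schwarz in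
`‖D_Wμ‖² = ⟨Δ_Wμ, μ⟩`. [folklore] -/
theorem sum_nhsNormSq_gaugeDir_le_covLap [Nonempty n] {L N : ℕ} (hL : 2 ≤ L) (j : ℕ) [NeZero (N * L ^ (j + 1))]
    {W : Site d → Fin d → (Matrix n n ℂ)ˣ} {x : ℝ} (hWu : IsUnitaryCfg W) (hWP : IsPeriodicCfg W ((N * L ^ (j + 1) : ℕ) : ℤ))
    (hx : 0 ≤ x) (hsm : LevelSmall d L j x) (hWx : SmallField W x)
    (hsmall : 8 * d * (((L : ℝ) ^ (j + 1)) * (((d : ℝ) - 1) * (((L : ℝ) ^ (j + 1)) - 1) * x)) ^ 2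
      + 2 * (Fintype.card n * (4 * (d : ℝ) ^ 2 * ((L : ℝ) ^ (j + 1) - 1) ^ 2 * x + 16 * d * loopRad d L ((prop1Radius d L)^[j] x)) ^ 2) ≤ 1 / 2)
    {μ : Site d → Matrix n n ℂ} (hμ : μ ∈ avgKernelGauges (d := d) (n := n) L N (j + 1) W) :
    ∑ x ∈ periodBox (d := d) (N * L ^ (j + 1)), ∑ κ : Fin d, nhsNormSq (gaugeDir W μ x κ)
      ≤ 4 * ((L : ℝ) ^ (j + 1)) ^ 2 * ∑ x ∈ periodBox (d := d) (N * L ^ (j + 1)), nhsNormSq (covLapSite W μ x) := by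
  obtain ⟨-, hμP, hμ0⟩ := mem_avgKernelGauges_iff.mp hμ
  have hP : 1 ≤ N * L ^ (j + 1) := Nat.one_le_iff_ne_zero.mpr (NeZero.ne _)
  set B := ∑ x ∈ periodBox (d := d) (N * L ^ (j + 1)), ∑ κ : Fin d, nhsNormSq (gaugeDir W μ x κ) with hB
  set A := ∑ x ∈ periodBox (d := d) (N * L ^ (j + 1)), nhsNormSq (μ x) with hA
  set C := ∑ x ∈ periodBox (d := d) (N * L ^ (j + 1)), nhsNormSq (covLapSite W μ x) with hC
  -- row NE3's Poincaré: `A ≤ 4M²·B`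
  have hPoinc : A ≤ 4 * (((L : ℝ) ^ (j + 1)) ^ 2 * B) := by
    have h := sum_nhsNormSq_le_four_mul_of_bmeanIterW_eq_zero hL j hWu hx hsm hWx N μ (fun z _ => by rw [hμ0]; rfl) hsmall
    rwa [Nat.mul_comm] at h
  -- Cauchy–Schwarz on the torus sections: `B = ⟪resS Δμ, resS μ⟫ ≤ ‖resS Δμ‖·‖resS μ‖`, `‖resS Δμ‖² = C`, `‖resS μ‖² = A`
  have hBeq : B = ⟪resS (d := d) (N * L ^ (j + 1)) (covLapSite W μ), resS (N * L ^ (j + 1)) μ⟫_ℝ := by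
    rw [inner_resS, hB, sum_nhsNormSq_gaugeDir_eq_sum_hsR_covLapSite hP hWu hWP hμP]
  have hB0 : 0 ≤ B := Finset.sum_nonneg fun x _ => Finset.sum_nonneg fun κ _ => nhsNormSq_nonneg _
  have hA0 : 0 ≤ A := Finset.sum_nonneg fun x _ => nhsNormSq_nonneg _
  have hC0 : 0 ≤ C := Finset.sum_nonneg fun x _ => nhsNormSq_nonneg _
  have hCS : B ^ 2 ≤ C * A := by
    have h1 : B ≤ ‖resS (d := d) (N * L ^ (j + 1)) (covLapSite W μ)‖ * ‖resS (d := d) (N * L ^ (j + 1)) μ‖ := by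
      rw [hBeq]; exact real_inner_le_norm _ _
    have h2 : B ^ 2 ≤ (‖resS (d := d) (N * L ^ (j + 1)) (covLapSite W μ)‖ * ‖resS (d := d) (N * L ^ (j + 1)) μ‖) ^ 2 :=
      pow_le_pow_left₀ hB0 h1 2
    rw [mul_pow, norm_sq_resS, norm_sq_resS] at h2
    exact h2
  -- `B² ≤ C·A ≤ C·4M²B` ⟹ `B ≤ 4M²C`
  by_cases hBz : B = 0
  · rw [hBz]; positivity
  · have hBpos : 0 < B := lt_of_le_of_ne hB0 (Ne.symm hBz)
    have h3 : B ^ 2 ≤ C * (4 * (((L : ℝ) ^ (j + 1)) ^ 2 * B)) := hCS.trans (mul_le_mul_of_nonneg_left hPoinc hC0)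
    nlinarith

/-! ## §2 The Hessian on a pure gauge is tension-small (AM–GM form) -/

/-- **`|hess W (D_Wμ) (D_Wμ)| ≤ τ·card n·(ε·d·Σ nhsNormSq μ + ε⁻¹·Σ nhsNormSq(D_Wμ))`** for every `ε > 0` (F208 + AM–GM + `‖X‖² ≤ card n·nhsNormSq X`). [folklore] -/
theorem abs_hess_pureGauge_le {P : ℕ} [NeZero P] {W : Site d → Fin d → (Matrix n n ℂ)ˣ} (hWu : IsUnitaryCfg W) (hWP : IsPeriodicCfg W (P : ℤ))
    {τ : ℝ} (hτ : 0 ≤ τ)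
    (hten : ∀ K : Site d → Fin d → Matrix n n ℂ, IsSkewDir K → IsPeriodicDir K (P : ℤ) → |dAction W K (perWin d P)| ≤ τ * dirL1 K (periodBox (d := d) P))
    {μ : Site d → Matrix n n ℂ} (hμs : ∀ x, μ x ∈ skewAdjoint (Matrix n n ℂ)) (hμP : ∀ (x : Site d) (i : Fin d), μ (x + (P : ℤ) • e i) = μ x)
    {ε : ℝ} (hε : 0 < ε) :
    |hess W (gaugeDir W μ) (gaugeDir W μ) (perWin d P)|
      ≤ τ * (Fintype.card n * (ε * (∑ x ∈ periodBox (d := d) P, ∑ _κ : Fin d, nhsNormSq (μ x))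
          + ε⁻¹ * ∑ x ∈ periodBox (d := d) P, ∑ κ : Fin d, nhsNormSq (gaugeDir W μ x κ))) := by
  have h1 := abs_hess_gaugeDir_right_le hWu hWP (perWin d P) (periodBox (d := d) P) hτ hten (gaugeDir_skew hWu hμs) (isPeriodicDir_gaugeDir hWP hμP) hμs hμP
  refine h1.trans ?_
  rw [show 2 * τ * ∑ x ∈ periodBox (d := d) P, ∑ κ : Fin d, ‖μ x‖ * ‖gaugeDir W μ x κ‖
      = τ * (2 * ∑ x ∈ periodBox (d := d) P, ∑ κ : Fin d, ‖μ x‖ * ‖gaugeDir W μ x κ‖) by ring]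
  refine mul_le_mul_of_nonneg_left ?_ hτ
  -- `2Σ‖μ‖‖Dμ‖ ≤ Σ(ε‖μ‖² + ε⁻¹‖Dμ‖²) ≤ card n·(ε d Σ nhsNormSq μ + ε⁻¹ Σ nhsNormSq Dμ)`
  have hterm : ∀ (x : Site d) (κ : Fin d), 2 * (‖μ x‖ * ‖gaugeDir W μ x κ‖)
      ≤ ε * (Fintype.card n * nhsNormSq (μ x)) + ε⁻¹ * (Fintype.card n * nhsNormSq (gaugeDir W μ x κ)) := by
    intro x κ
    have ha := opNorm_sq_le_card_mul_nhsNormSq (μ x)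
    have hb := opNorm_sq_le_card_mul_nhsNormSq (gaugeDir W μ x κ)
    have hamgm : 2 * (‖μ x‖ * ‖gaugeDir W μ x κ‖) ≤ ε * ‖μ x‖ ^ 2 + ε⁻¹ * ‖gaugeDir W μ x κ‖ ^ 2 := by
      have hε' : 0 < ε⁻¹ := inv_pos.mpr hε
      nlinarith [sq_nonneg (ε * ‖μ x‖ - ‖gaugeDir W μ x κ‖), mul_inv_cancel₀ hε.ne', norm_nonneg (μ x), norm_nonneg (gaugeDir W μ x κ),
        sq_nonneg ‖gaugeDir W μ x κ‖]
    calc 2 * (‖μ x‖ * ‖gaugeDir W μ x κ‖) ≤ ε * ‖μ x‖ ^ 2 + ε⁻¹ * ‖gaugeDir W μ x κ‖ ^ 2 := hamgm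
      _ ≤ ε * (Fintype.card n * nhsNormSq (μ x)) + ε⁻¹ * (Fintype.card n * nhsNormSq (gaugeDir W μ x κ)) := by gcongr
  calc 2 * ∑ x ∈ periodBox (d := d) P, ∑ κ : Fin d, ‖μ x‖ * ‖gaugeDir W μ x κ‖
      = ∑ x ∈ periodBox (d := d) P, ∑ κ : Fin d, 2 * (‖μ x‖ * ‖gaugeDir W μ x κ‖) := by
        rw [Finset.mul_sum]; exact Finset.sum_congr rfl fun x _ => by rw [Finset.mul_sum]
    _ ≤ ∑ x ∈ periodBox (d := d) P, ∑ κ : Fin d, (ε * (Fintype.card n * nhsNormSq (μ x)) + ε⁻¹ * (Fintype.card n * nhsNormSq (gaugeDir W μ x κ))) :=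
        Finset.sum_le_sum fun x _ => Finset.sum_le_sum fun κ _ => hterm x κ
    _ = Fintype.card n * (ε * (∑ x ∈ periodBox (d := d) P, ∑ _κ : Fin d, nhsNormSq (μ x))
          + ε⁻¹ * ∑ x ∈ periodBox (d := d) P, ∑ κ : Fin d, nhsNormSq (gaugeDir W μ x κ)) := by
        simp only [Finset.sum_add_distrib, ← Finset.mul_sum]
        ring

/-! ## §3 The pure-gauge diagonal of (P_a) -/

/-- **THE PURE-GAUGE DIAGONAL OF THE POSITIVITY LETTER.**  For `μ ∈ N(Q′(W))` (skew, `(N·L^{j+1})`-periodic, nested mean zero) and `g = D_Wμ` on the skew torus 1-forms, every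
`a ≥ 0` and every `ε > 0`:
`(1∕(4M²) − τ·card n·(4dM²ε + ε⁻¹))·Σ nhsNormSq(D_Wμ) ≤ ⟪g, softSymOpKa a g⟫` — the gauge-fixing square `‖Δ_Wμ‖² ≥ ‖D_Wμ‖²∕(4M²)` beats the tension-small Hessian. [folklore] -/
theorem inner_softSymOpKa_pureGauge_ge [Nonempty n] {L N : ℕ} [NeZero N] (hL : 1 ≤ L) (hL2 : 2 ≤ L) (j : ℕ) [NeZero (N * L ^ (j + 1))]
    {W : Site d → Fin d → (Matrix n n ℂ)ˣ} {x : ℝ} (hWu : IsUnitaryCfg W) (hWP : IsPeriodicCfg W ((N * L ^ (j + 1) : ℕ) : ℤ))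
    (hx : 0 ≤ x) (hs : LevelSmall d L j x) (hWx : SmallField W x)
    (hsmall : 8 * d * (((L : ℝ) ^ (j + 1)) * (((d : ℝ) - 1) * (((L : ℝ) ^ (j + 1)) - 1) * x)) ^ 2
      + 2 * (Fintype.card n * (4 * (d : ℝ) ^ 2 * ((L : ℝ) ^ (j + 1) - 1) ^ 2 * x + 16 * d * loopRad d L ((prop1Radius d L)^[j] x)) ^ 2) ≤ 1 / 2)
    {τ : ℝ} (hτ : 0 ≤ τ)
    (hten : ∀ K : Site d → Fin d → Matrix n n ℂ, IsSkewDir K → IsPeriodicDir K ((N * L ^ (j + 1) : ℕ) : ℤ) →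
      |dAction W K (perWin d (N * L ^ (j + 1)))| ≤ τ * dirL1 K (periodBox (d := d) (N * L ^ (j + 1))))
    {a : ℝ} (ha : 0 ≤ a) {μ : Site d → Matrix n n ℂ} (hμ : μ ∈ avgKernelGauges (d := d) (n := n) L N (j + 1) W) {ε : ℝ} (hε : 0 < ε) :
    (1 / (4 * ((L : ℝ) ^ (j + 1)) ^ 2) - τ * (Fintype.card n * (4 * d * ((L : ℝ) ^ (j + 1)) ^ 2 * ε + ε⁻¹)))
        * ∑ y ∈ periodBox (d := d) (N * L ^ (j + 1)), ∑ κ : Fin d, nhsNormSq (gaugeDir W μ y κ)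
      ≤ ⟪gradOpK hWu (N * L ^ (j + 1)) ⟨resS (N * L ^ (j + 1)) μ, resS_mem_of_avgKernel hμ⟩,
          softSymOpKa (N := N) hL j hWu hx hs hWx a (gradOpK hWu (N * L ^ (j + 1)) ⟨resS (N * L ^ (j + 1)) μ, resS_mem_of_avgKernel hμ⟩)⟫_ℝ := by
  obtain ⟨hμs, hμP, -⟩ := mem_avgKernelGauges_iff.mp hμ
  have hP : 1 ≤ N * L ^ (j + 1) := Nat.one_le_iff_ne_zero.mpr (NeZero.ne _)
  have hM : (0 : ℝ) < ((L : ℝ) ^ (j + 1)) ^ 2 := by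
    have : (0 : ℝ) < L := by exact_mod_cast (show 0 < L by omega)
    positivity
  set B := ∑ y ∈ periodBox (d := d) (N * L ^ (j + 1)), ∑ κ : Fin d, nhsNormSq (gaugeDir W μ y κ) with hB
  set A := ∑ y ∈ periodBox (d := d) (N * L ^ (j + 1)), nhsNormSq (μ y) with hA
  set C := ∑ y ∈ periodBox (d := d) (N * L ^ (j + 1)), nhsNormSq (covLapSite W μ y) with hC
  have hB0 : 0 ≤ B := Finset.sum_nonneg fun y _ => Finset.sum_nonneg fun κ _ => nhsNormSq_nonneg _
  -- the quadratic form: hess + C + a⟪Qg,Qg⟫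
  rw [inner_softSymOpKa_self, inner_gaugeFix_pureGauge hWu hP hWP hμ]
  have hext : extF (N * L ^ (j + 1)) ((gradOpK hWu (N * L ^ (j + 1)) ⟨resS (N * L ^ (j + 1)) μ, resS_mem_of_avgKernel hμ⟩ : skewForms d n (N * L ^ (j + 1)))
      : Form d n (N * L ^ (j + 1))) = gaugeDir W μ := by
    rw [coe_gradOpK_resS hWu hμ, extF_resF _ (isPeriodicDir_gaugeDir hWP hμP)]
  rw [hext]
  -- the three estimates
  have hQ : 0 ≤ a * ⟪qbarOpK (N := N) hL j hWu hx hs hWx (gradOpK hWu (N * L ^ (j + 1)) ⟨resS (N * L ^ (j + 1)) μ, resS_mem_of_avgKernel hμ⟩),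
      qbarOpK (N := N) hL j hWu hx hs hWx (gradOpK hWu (N * L ^ (j + 1)) ⟨resS (N * L ^ (j + 1)) μ, resS_mem_of_avgKernel hμ⟩)⟫_ℝ :=
    mul_nonneg ha real_inner_self_nonneg
  have hPoinc : A ≤ 4 * (((L : ℝ) ^ (j + 1)) ^ 2 * B) := by
    obtain ⟨-, -, hμ0⟩ := mem_avgKernelGauges_iff.mp hμ
    have h := sum_nhsNormSq_le_four_mul_of_bmeanIterW_eq_zero hL2 j hWu hx hs hWx N μ (fun z _ => by rw [hμ0]; rfl) hsmall
    rwa [Nat.mul_comm] at h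
  have hBC : B ≤ 4 * ((L : ℝ) ^ (j + 1)) ^ 2 * C := sum_nhsNormSq_gaugeDir_le_covLap hL2 j hWu hWP hx hs hWx hsmall hμ
  have hH := abs_hess_pureGauge_le hWu hWP hτ hten hμs hμP hε
  have hdA : ∑ y ∈ periodBox (d := d) (N * L ^ (j + 1)), ∑ _κ : Fin d, nhsNormSq (μ y) = d * A := by
    rw [hA, Finset.mul_sum]
    exact Finset.sum_congr rfl fun y _ => by rw [Finset.sum_const, Finset.card_univ, Fintype.card_fin, nsmul_eq_mul]
  rw [hdA] at hH
  have hH' : -(τ * (Fintype.card n * (ε * (d * A) + ε⁻¹ * B))) ≤ hess W (gaugeDir W μ) (gaugeDir W μ) (perWin d (N * L ^ (j + 1))) :=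
    (abs_le.mp hH).1
  -- `hess ≥ −τ n (ε d A + ε⁻¹ B) ≥ −τ n (ε d 4M² B + ε⁻¹ B)`, `C ≥ B∕(4M²)`
  have hA' : ε * (d * A) ≤ ε * (d * (4 * (((L : ℝ) ^ (j + 1)) ^ 2 * B))) := by gcongr
  have hCge : 1 / (4 * ((L : ℝ) ^ (j + 1)) ^ 2) * B ≤ C := by
    rw [div_mul_eq_mul_div, one_mul, div_le_iff₀ (by positivity)]
    linarith
  have hn : (0 : ℝ) ≤ Fintype.card n := Nat.cast_nonneg _
  nlinarith [mul_nonneg hτ (mul_nonneg hn (sub_nonneg.mpr hA')), hQ, hCge, hH']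

end

end Summit.QuantumFields.BalabanUV.T4Continuum.NE7SoftOperatorGaugePositivity
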